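/-
Copyright (c) 2026 the pub-hodgecm-mathlib formalisation cell (harness21).  Prover seat hodgecm-mathlib-K2Liu-p14 (g0): Track B «K2-LIT»,
hLiu418 = stmt-HodgeConjecture-24832; LEAD F0P6-plan (g13) RULING M-157b + «=» 2026-09-04T08:59:05Z «(β4-ii) → (β4-i) → (β4-iii)», file (β4-i) part A.
-/
import Summits.HodgeConjecture.HodgeConjecture.Theorems.K2LiuGL2GodementSectionOfFlatFinite   -- ★ (β1): primitive rows of `GL₂(𝒪)`, `congruenceGL`, `ValBound`
import HarnessLib

/-!
# Crux `HLiu418`, road `K2_Liu`, Road Φ organ G5 (β) «Godement sections exhaust», file (β4-i) part A: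
# PRIMITIVE ROWS OF `GL₂(𝒪)` — neighbourhoods, scalar multiples, and the congruence move `e₂(k u) = e₂ k + t`

Cell `hodgecm-mathlib`, crux item hLiu418 = `stmt-HodgeConjecture-24832`; prover K2Liu-p14 (g0).  THEOREMS ONLY (no `def`, no instance, no notation,
no named-fact hypothesis, no `sorry`); lane `--supports stmt-HodgeConjecture-24832` (count-neutral helper).  GENERIC field `F` with a `ValuativeRel`
(★ `GLnCongruenceSubgroups` ∕ ★ (β1) `K2LiuGL2GodementSectionOfFlatFinite` currency; «`x` primitive» is spelled inline as
`(∀ j, valuation F (x j) ≤ 1) ∧ ∃ j, valuation F (x j) = 1`, as in ★ (β1)).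
The LOCAL ROW ALGEBRA behind the finite-adelic primitive-shell Schwartz function of (β4-i) part B (`K2LiuGL2GodementFiniteAdelicShell`), factored out
of the proof of ★ (β1) `exists_schwartzBruhat_of_flat` so that part B can run it at every place of a finite set `S` simultaneously:
* §1 `prim_of_forall_valuation_sub_lt_one` ∕ `not_prim_of_forall_valuation_sub_lt_one` (primitivity is constant on balls of radius `< 1`),
  `forall_valuation_le_one_iff_of_sub` (integrality is constant on integral translates), `forall_valuation_smul_le_one_iff` ∕ **`prim_smul_iff`**
  (`a · x` integral ⇔ `|a| ≤ 1`, primitive ⇔ `|a| = 1`, for `x` primitive);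
* §2 **`exists_congruenceGL_mul_apply_one_eq`**: for `k ∈ K = GL₂(𝒪)` and `y` with `|y − e₂k| ≤ γ < 1` coordinatewise there is `u ∈ K_γ` (principal congruence
  subgroup ★ `congruenceGL 2 γ`) with `e₂(k u) = y` — the matrix `U = (1 0; c₀ 1+c₁)`, `c = (y − e₂k)k⁻¹`, conjugated into `K_γ ⊲ K` (★ `conj_mem_congruenceGL`).
HONEST LABEL.  `HC_CM` is proved only modulo the 7 printed citations (2 remaining named inputs: hLiu418 = `stmt-HodgeConjecture-24832`,
h413 = `stmt-HodgeConjecture-24833`) until rung 0 closes.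

## References
* [Bump1997] D. Bump, *Automorphic Forms and Representations* (1997), §3.7, Prop. 4.5.2 (rows of `GL₂(𝒪)`, the sections `f_Φ`).
* [JacquetLanglands1970] H. Jacquet, R. P. Langlands, *Automorphic forms on GL(2)*, LNM 114 (1970), §3.
* [Casselman1995] W. Casselman, *Introduction to the theory of admissible representations of 𝔭-adic reductive groups* (1995 notes), Prop. 1.4.4 (`K_γ ⊲ K`).
-/

set_option autoImplicit false
set_option linter.dupNamespace false -- the mandated namespace repeats `HodgeConjecture.HodgeConjecture`

noncomputable section

open ValuativeRel
open scoped MatrixGroups Matrix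
open Literature.NumberTheory.GaloisRepresentations
open Literature.NumberTheory.Automorphic
open Summit.HodgeConjecture.HodgeConjecture.Cruxes.HLiu418.K2LiuGL2GodementSectionOfFlatFinite

namespace Summit.HodgeConjecture.HodgeConjecture.Cruxes.HLiu418.K2LiuGL2PrimitiveRowNeighbourhoods

variable {F : Type*} [Field F] [ValuativeRel F]

/-! ## §1 Primitivity and integrality near a vector; scalar multiples of a primitive vector -/

/-- **primitivity is constant on balls of radius `< 1`**: `x` primitive and `|y_j − x_j| < 1` for all `j` ⇒ `y` primitive. [cite: Bump1997, Prop. 4.5.2] -/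
theorem prim_of_forall_valuation_sub_lt_one {x y : Fin 2 → F} (hx : (∀ j, valuation F (x j) ≤ 1) ∧ ∃ j, valuation F (x j) = 1)
    (hy : ∀ j, valuation F ((y - x) j) < 1) : (∀ j, valuation F (y j) ≤ 1) ∧ ∃ j, valuation F (y j) = 1 := by
  obtain ⟨hle, j₀, hj₀⟩ := hx
  have hyj : ∀ j, y j = (y - x) j + x j := fun j => by simp
  refine ⟨fun j => ?_, ⟨j₀, ?_⟩⟩
  · rw [hyj j]
    exact (Valuation.map_add _ _ _).trans (max_le (hy j).le (hle j))
  · rw [hyj j₀, Valuation.map_add_eq_of_lt_right _ (lt_of_lt_of_eq (hy j₀) hj₀.symm), hj₀]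

/-- … hence NON-primitivity is constant on such balls too. [cite: Bump1997, Prop. 4.5.2] -/
theorem not_prim_of_forall_valuation_sub_lt_one {x y : Fin 2 → F} (hx : ¬ ((∀ j, valuation F (x j) ≤ 1) ∧ ∃ j, valuation F (x j) = 1))
    (hy : ∀ j, valuation F ((y - x) j) < 1) : ¬ ((∀ j, valuation F (y j) ≤ 1) ∧ ∃ j, valuation F (y j) = 1) := by
  intro h
  refine hx (prim_of_forall_valuation_sub_lt_one h fun j => ?_)
  rw [Pi.sub_apply, Valuation.map_sub_swap, ← Pi.sub_apply]
  exact hy j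

/-- **integrality is constant on integral translates**: `|y_j − x_j| ≤ 1` for all `j` ⇒ (`y` integral ⇔ `x` integral). [folklore] -/
theorem forall_valuation_le_one_iff_of_sub {x y : Fin 2 → F} (hy : ∀ j, valuation F ((y - x) j) ≤ 1) :
    (∀ j, valuation F (y j) ≤ 1) ↔ ∀ j, valuation F (x j) ≤ 1 := by
  have hyj : ∀ j, y j = (y - x) j + x j := fun j => by simp
  have hxj : ∀ j, x j = y j - (y - x) j := fun j => by simp
  constructor
  · intro h j
    rw [hxj j]
    exact (Valuation.map_sub _ _ _).trans (max_le (h j) (hy j))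
  · intro h j
    rw [hyj j]
    exact (Valuation.map_add _ _ _).trans (max_le (hy j) (h j))

/-- **`a · x` is integral iff `|a| ≤ 1`**, for `x` primitive. [cite: Bump1997, Prop. 4.5.2] -/
theorem forall_valuation_smul_le_one_iff {x : Fin 2 → F} (hx : (∀ j, valuation F (x j) ≤ 1) ∧ ∃ j, valuation F (x j) = 1) (a : F) :
    (∀ j, valuation F ((a • x) j) ≤ 1) ↔ valuation F a ≤ 1 := by
  obtain ⟨hle, j₀, hj₀⟩ := hx
  constructor
  · intro h
    have := h j₀
    rwa [Pi.smul_apply, smul_eq_mul, map_mul, hj₀, mul_one] at this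
  · intro ha j
    rw [Pi.smul_apply, smul_eq_mul, map_mul]
    exact (mul_le_mul' ha (hle j)).trans (by rw [mul_one])

/-- **`a · x` is primitive iff `|a| = 1`**, for `x` primitive (★ (β1) `prim_smul_apply_one_iff` for the rows of `K`, here for any primitive vector and any
scalar). [cite: Bump1997, Prop. 4.5.2] -/
theorem prim_smul_iff {x : Fin 2 → F} (hx : (∀ j, valuation F (x j) ≤ 1) ∧ ∃ j, valuation F (x j) = 1) (a : F) :
    ((∀ j, valuation F ((a • x) j) ≤ 1) ∧ ∃ j, valuation F ((a • x) j) = 1) ↔ valuation F a = 1 := by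
  obtain ⟨hle, j₀, hj₀⟩ := hx
  constructor
  · rintro ⟨hle', j₁, hj₁⟩
    have h1 : valuation F a ≤ 1 := by
      have := hle' j₀
      rwa [Pi.smul_apply, smul_eq_mul, map_mul, hj₀, mul_one] at this
    rw [Pi.smul_apply, smul_eq_mul, map_mul] at hj₁
    refine le_antisymm h1 ?_
    by_contra hlt
    push Not at hlt
    have : valuation F a * valuation F (x j₁) < 1 := mul_lt_one_of_lt_of_le hlt (hle j₁)
    exact this.ne hj₁
  · intro ha
    refine ⟨fun j => ?_, ⟨j₀, ?_⟩⟩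
    · rw [Pi.smul_apply, smul_eq_mul, map_mul, ha, one_mul]
      exact hle j
    · rw [Pi.smul_apply, smul_eq_mul, map_mul, ha, one_mul, hj₀]

/-! ## §2 The congruence move: `e₂ (k u) = e₂ k + t` with `u ∈ K_γ` -/

/-- **THE CONGRUENCE MOVE.**  For `k ∈ K = GL₂(𝒪)`, `γ < 1` and `y` with `|y_j − (e₂k)_j| ≤ γ` there is `u ∈ K_γ = congruenceGL 2 γ` with `e₂(k u) = y`:
with `c := (y − e₂k)k⁻¹` (entries of valuation `≤ γ`) the matrix `U = (1 0; c₀ 1+c₁)` lies in `K_γ` and `e₂(U k) = e₂k + c k = y`; then `k u = U k` for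
`u := k⁻¹ U k ∈ K_γ` (★ `conj_mem_congruenceGL`).  (Extracted from the proof of ★ (β1) `exists_schwartzBruhat_of_flat`.)
[cite: JacquetLanglands1970, §3] [cite: Casselman1995, Prop. 1.4.4] -/
theorem exists_congruenceGL_mul_apply_one_eq {γ : ValueGroupWithZero F} (hγ : γ < 1) {k : GL (Fin 2) F} (hk : k ∈ glInt 2 F)
    {y : Fin 2 → F} (hy : ∀ j, valuation F ((y - (k : Matrix (Fin 2) (Fin 2) F) 1) j) ≤ γ) :
    ∃ u ∈ congruenceGL 2 γ, ((k * u : GL (Fin 2) F) : Matrix (Fin 2) (Fin 2) F) 1 = y := by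
  set x : Fin 2 → F := (k : Matrix (Fin 2) (Fin 2) F) 1 with hx
  set c : Fin 2 → F := (y - x) ᵥ* ((k⁻¹ : GL (Fin 2) F) : Matrix (Fin 2) (Fin 2) F) with hc
  have hcγ : ∀ j, valuation F (c j) ≤ γ := by
    intro j
    have hcj : c j = ∑ i, (y - x) i * ((k⁻¹ : GL (Fin 2) F) : Matrix (Fin 2) (Fin 2) F) i j := rfl
    rw [hcj]
    refine (Valuation.map_sum_le _ fun i _ => ?_)
    rw [map_mul]
    exact (mul_le_mul' (hy i) (valuation_apply_le_one_of_mem_glInt (Subgroup.inv_mem _ hk) i j)).trans (by rw [mul_one])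
  set U : Matrix (Fin 2) (Fin 2) F := !![1, 0; c 0, 1 + c 1] with hU
  have hU1 : ValBound γ (U - 1) := by
    intro i j
    fin_cases i <;> fin_cases j
    · simp [hU]
    · simp [hU]
    · simpa [hU] using hcγ 0
    · simpa [hU] using hcγ 1
  obtain ⟨hUdet, hUinv1, hUinvγ⟩ := isUnit_det_and_valBound_inv hU1 hγ
  set u : GL (Fin 2) F := Matrix.GeneralLinearGroup.mk'' U hUdet with hu
  have hucoe : (u : Matrix (Fin 2) (Fin 2) F) = U := rfl
  have huγ : u ∈ congruenceGL 2 γ := by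
    refine ⟨⟨?_, ?_⟩, ?_, ?_⟩
    · rw [hucoe]; exact hU1.of_sub_one hγ.le
    · rw [Matrix.coe_units_inv, hucoe]; exact hUinv1
    · rw [hucoe]; exact hU1
    · rw [Matrix.coe_units_inv, hucoe]; exact hUinvγ
  -- `e₂ (U k) = e₂ k + c k = y`
  have hrow : ((u * k : GL (Fin 2) F) : Matrix (Fin 2) (Fin 2) F) 1 = y := by
    have h1 : (U 1) = Pi.single 1 1 + c := by
      ext j; fin_cases j <;> simp [hU]
    have h2 : ((u * k : GL (Fin 2) F) : Matrix (Fin 2) (Fin 2) F) 1 = (U 1) ᵥ* (k : Matrix (Fin 2) (Fin 2) F) := by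
      ext j; rw [Units.val_mul, hucoe, Matrix.mul_apply]; rfl
    rw [h2, h1, Matrix.add_vecMul, single_one_vecMul_eq, hc, Matrix.vecMul_vecMul, ← Units.val_mul, inv_mul_cancel,
      Units.val_one, Matrix.vecMul_one, hx, add_sub_cancel]
  -- conjugate: `k (k⁻¹ U k) = U k`, `k⁻¹ U k ∈ K_γ`
  have hconj : k⁻¹ * u * k⁻¹⁻¹ ∈ congruenceGL 2 γ := conj_mem_congruenceGL (Subgroup.inv_mem _ hk) huγ
  rw [inv_inv] at hconj
  refine ⟨k⁻¹ * u * k, hconj, ?_⟩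
  rw [← mul_assoc, ← mul_assoc, mul_inv_cancel, one_mul]
  exact hrow

end Summit.HodgeConjecture.HodgeConjecture.Cruxes.HLiu418.K2LiuGL2PrimitiveRowNeighbourhoods

end
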